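import Summits.QuantumFields.YangMills.Theorems.BalabanLadderNTMirrorHankelShift
import HarnessLib

/-!
# Crux `NT` (stmt-QuantumFields-19353): the HANKEL structure of the mirror form in the time separation

Helper file (`--supports stmt-QuantumFields-19353`) of the fleet lead prover of crux `NT` (unit `ym-spine-19353-p1`,
g10), hypothesis-free; sequel of `…NTMirrorHankelShift` (time translates `timeShift n F`, Hankel-form translation
invariance).  Clause (i) of `LowerBounds` / clause 4 of the registered stub `RefPkgT` (v4T) and the seam's (MF)
currency are floors on the MIRROR FORM `Cov_T(F∘ϑ, F)` of a positive-time observable `F` (the smeared action density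
carried by one femto cube) against its site-time-reflection `ϑ` on the odd tori `(ℤ/(2S+1)ℤ)^d`.  This file records
the exact Osterwalder–Schrader structure of that currency in the TIME-SEPARATION variable, for every dimension `d`,
every compact group `G`, every continuous unitary matrix representation `ρ`, every `β ≥ 0`, every odd side
`2S+1 ≥ 3` and every bounded measurable real observable `F` of the closed slab `0 ≤ t ≤ T`:

* `cov_timeReflect_self_nonneg_odd`, `integral_mul_negReflect_nonneg_odd`, `cov_negReflect_self_nonneg_odd_pos` — the
  two reflection positivities of the odd torus (link reflection `Θ`, site reflection `ϑ`) in COVARIANCE form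
  (`0 ≤ ∫ H·H∘Θ − (∫H)²`, `0 ≤ ∫ H∘ϑ·H − (∫H)²`; the tree had the Schwarz inequalities, p480409/p481686);
* the MIRROR SEQUENCE `mirrorSeq ρ β F n = ∫ (F∘ϑ) · F_n − (∫F)(∫F_n)` (`= Cov_T(F∘ϑ, F_n)`; `cov_timeShift_negReflect_timeShift`:
  the pairing of ANY two translates `F_s∘ϑ`, `F_t` is `q(s+t)`) satisfies, while the translates stay in the
  non-negative half `t ≤ S`:
  - `mirrorSeq_even_nonneg` (`0 ≤ q(2s)`: site-RP of `F_s`), `mirrorSeq_odd_nonneg` (`0 ≤ q(2s+1)`: LINK-RP of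
    `F_{s+1}`, via `F_{s+1}∘Θ = F_s∘ϑ`), together **`mirrorSeq_nonneg`: `0 ≤ q(n)` for `2T + n ≤ 2S`**;
  - `sq_mirrorSeq_add_le` (`q(s+t)² ≤ q(2s)·q(2t)`, site RPCS), `sq_mirrorSeq_add_succ_le`
    (`q(s+t+1)² ≤ q(2s+1)·q(2t+1)`, link RPCS), whence **`mirrorSeq_logConvex`: `q(n+1)² ≤ q(n)·q(n+2)` for
    `2T + n + 2 ≤ 2S`**.

So the floor currency `n ↦ Cov_T(F∘ϑ, F_n)` is a non-negative LOG-CONVEX function of the distance to the mirror on every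
odd torus; both parities need both reflection positivities of the odd torus (`ϑ` = site reflection at `t = 0` = link
reflection at `t = S + ½`; `Θ` = link reflection at `t = ½`).  This is the finite-torus shadow of the transfer-matrix
formula `⟨ΘF, F_t⟩ = ‖e^{−tH/2} F̂Ω‖²`; consequences (three-point inequality, outward propagation of a floor, the cap a
β-uniform floor at separation `≍ κ/a(β)` puts on any clustering rate in the unit `a(β)`) follow in `…NTMirrorHankelConvex`.

Refs: K. Osterwalder, E. Seiler, Ann. Phys. 110 (1978) 440, §2; J. Fröhlich, R. Israel, E. Lieb, B. Simon, Commun.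
Math. Phys. 62 (1978) 1, Thm. 2.1; J. Glimm, A. Jaffe, *Quantum Physics* (1987) §6.1.  Tree:
`Reflection.sq_cov_negReflect_le_odd_pos`, `Reflection.sq_cov_timeReflect_le_odd`, `Reflection.integral_mul_timeReflect_nonneg_odd`.
-/

set_option autoImplicit false

noncomputable section

open MeasureTheory Finset
open Literature.MathematicalPhysics.QuantumFieldTheory
open Literature.MathematicalPhysics.QuantumFieldTheory.WilsonRP
open Literature.MathematicalPhysics.QuantumFieldTheory.WilsonOddRP
open Literature.MathematicalPhysics.QuantumFieldTheory.WilsonSiteRP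
open Literature.MathematicalPhysics.QuantumFieldTheory.WilsonNegRP
open Literature.MathematicalPhysics.QuantumFieldTheory.FariaDaVeigaOCarroll2022
open Summit.QuantumFields.YangMills.Cruxes.NT.Reflection

namespace Summit.QuantumFields.YangMills.Cruxes.NT.MirrorHankel

variable {d L N : ℕ} [NeZero d] [NeZero L]
variable {G : Type*} [Group G] [TopologicalSpace G] [IsTopologicalGroup G] [CompactSpace G]
  [MeasurableSpace G] [BorelSpace G] (ρ : G →* Matrix (Fin N) (Fin N) ℂ)

/-! ## §1 The two reflection positivities, covariance form -/

/-- **Link-reflection positivity, covariance form** (odd side `L ≥ 3`, `β ≥ 0`): for a bounded measurable real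
observable `H` of `oPosEdges ∪ oSharedEdges` (base times `1 … L/2` and the spatial links at `L/2 + 1`),
`0 ≤ ∫ H · H∘Θ − (∫H)²`. [cite: OsterwalderSeiler1978, §2] -/
theorem cov_timeReflect_self_nonneg_odd (hL : Odd L) (hL3 : 3 ≤ L) (hρ : Continuous ρ) {β : ℝ} (hβ : 0 ≤ β)
    {H : GaugeConfig d L G → ℝ} (hHm : Measurable H) (hHb : ∃ K : ℝ, ∀ U, |H U| ≤ K)
    (hHdep : DependsOn H ((oPosEdges ∪ oSharedEdges : Finset (Edge d L)) : Set (Edge d L))) :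
    0 ≤ ∫ U, H U * H U.timeReflect ∂(wilsonMeasure ρ β) - (∫ U, H U ∂(wilsonMeasure ρ β)) ^ 2 := by
  set c := ∫ U, H U ∂(wilsonMeasure ρ β) with hc
  obtain ⟨K, hK⟩ := hHb
  have hH'm : Measurable fun U => H U - c := hHm.sub measurable_const
  have hH'b : ∃ K' : ℝ, ∀ U, |H U - c| ≤ K' := ⟨K + |c|, fun U => (abs_sub _ _).trans (by linarith [hK U])⟩
  have hH'dep : DependsOn (fun U => H U - c) ((oPosEdges ∪ oSharedEdges : Finset (Edge d L)) : Set (Edge d L)) :=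
    fun U V hUV => by simp only; rw [hHdep hUV]
  have h0 := integral_mul_timeReflect_nonneg_odd ρ hL hL3 hρ hβ hH'm hH'b hH'dep
  have e := integral_centred_mul_timeReflect ρ hρ β hHm hHm ⟨K, hK⟩ ⟨K, hK⟩
  rw [← hc] at e
  rw [e] at h0
  simpa only [sq] using h0

/-- Transport of the link-reflection positivity along `t ↦ t − S`: for a bounded measurable real observable `A` of
`negSideEdges S ∪ sliceZeroEdges` (side `L = 2S+1`, `S ≥ 1`, `β ≥ 0`), `0 ≤ ∫ A · A∘ϑ`. [cite: OsterwalderSeiler1978, §2] -/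
theorem integral_mul_negReflect_nonneg_odd {S : ℕ} (hL : L = 2 * S + 1) (hS : 1 ≤ S) (hρ : Continuous ρ) {β : ℝ}
    (hβ : 0 ≤ β) {A : GaugeConfig d L G → ℝ} (hAm : Measurable A) (hAb : ∃ K : ℝ, ∀ U, |A U| ≤ K)
    (hAdep : DependsOn A ((negSideEdges S ∪ sliceZeroEdges : Finset (Edge d L)) : Set (Edge d L))) :
    0 ≤ ∫ U, A U * A U.negReflect ∂(wilsonMeasure ρ β) := by
  have hodd : Odd L := ⟨S, hL⟩
  have hL3 : 3 ≤ L := by omega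
  set τ := torusConfigShift (G := G) (shiftVec (d := d) (L := L) S) with hτ
  have hτm : Measurable τ := (torusConfigShift (G := G) (shiftVec (d := d) (L := L) S)).measurable
  have hconj : ∫ U, A U * A U.negReflect ∂(wilsonMeasure ρ β) =
      ∫ U, (A ∘ τ) U * (A ∘ τ) U.timeReflect ∂(wilsonMeasure ρ β) := by
    rw [← integral_comp_torusConfigShift ρ β (shiftVec (d := d) (L := L) S) (fun U => A U * A U.negReflect)]
    refine integral_congr_ae (ae_of_all _ fun U => ?_)
    simp only [Function.comp_apply, hτ, negReflect_torusConfigShift hL]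
  rw [hconj]
  exact integral_mul_timeReflect_nonneg_odd ρ hodd hL3 hρ hβ (hAm.comp hτm) (hAb.imp fun _ hK _ => hK _)
    (dependsOn_comp_shift_of_negSide hL hS hAdep)

omit [TopologicalSpace G] [IsTopologicalGroup G] [CompactSpace G] [MeasurableSpace G] [BorelSpace G] [Group G]
  [NeZero L] in
/-- A slab `[lo, hi]` with `hi ≤ S` lies in the closed non-negative half of the tree's positive-half form. [folklore] -/
theorem slab_subset_posHalf {lo hi S : ℕ} (h : hi ≤ S) :
    slab (d := d) (L := L) lo hi ⊆ {e : Edge d L | (e.1 0).val ≤ S ∧ ((e.1.shift e.2) 0).val ≤ S} := by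
  intro e he
  obtain ⟨-, h1, h2⟩ := he
  exact ⟨h1.trans h, h2.trans h⟩

/-- **Site-reflection positivity, covariance form** (side `L = 2S+1`, `S ≥ 1`, `β ≥ 0`): for a bounded measurable real
observable `H` of the closed non-negative half (both endpoints at times `≤ S`), `0 ≤ ∫ H∘ϑ · H − (∫H)²`
(`ϑ = GaugeConfig.negReflect`). [cite: OsterwalderSeiler1978, §2] -/
theorem cov_negReflect_self_nonneg_odd_pos {S : ℕ} (hL : L = 2 * S + 1) (hS : 1 ≤ S) (hρ : Continuous ρ) {β : ℝ}
    (hβ : 0 ≤ β) {H : GaugeConfig d L G → ℝ} (hHm : Measurable H) (hHb : ∃ K : ℝ, ∀ U, |H U| ≤ K)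
    (hHdep : DependsOn H {e : Edge d L | (e.1 0).val ≤ S ∧ ((e.1.shift e.2) 0).val ≤ S}) :
    0 ≤ ∫ U, H U.negReflect * H U ∂(wilsonMeasure ρ β) - (∫ U, H U ∂(wilsonMeasure ρ β)) ^ 2 := by
  haveI := isProbabilityMeasure_wilsonMeasure (d := d) (L := L) ρ hρ β
  set μ := wilsonMeasure (d := d) (L := L) ρ β with hμ
  set c := ∫ U, H U ∂μ with hc
  obtain ⟨K, hK⟩ := hHb
  have hϑm : Measurable (GaugeConfig.negReflect : GaugeConfig d L G → GaugeConfig d L G) := measurable_negReflect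
  -- the centred reflected observable lives on the negative blocks
  set A : GaugeConfig d L G → ℝ := fun U => H U.negReflect - c with hA
  have hAm : Measurable A := (hHm.comp hϑm).sub measurable_const
  have hAb : ∃ K' : ℝ, ∀ U, |A U| ≤ K' := ⟨K + |c|, fun U => (abs_sub _ _).trans (by linarith [hK U.negReflect])⟩
  have hAdep : DependsOn A ((negSideEdges S ∪ sliceZeroEdges : Finset (Edge d L)) : Set (Edge d L)) := by
    intro U V hUV
    have h := dependsOn_negReflect_of_posHalf hL hS hHdep hUV
    simp only at h
    simp only [hA, h]
  have h0 := integral_mul_negReflect_nonneg_odd ρ hL hS hρ hβ hAm hAb hAdep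
  -- integrability bookkeeping
  have iH : Integrable H μ := integrable_wilson_of_bdd ρ hρ β hHm ⟨K, hK⟩
  have iHϑ : Integrable (fun U => H U.negReflect) μ := integrable_wilson_of_bdd ρ hρ β (hHm.comp hϑm) ⟨K, fun U => hK _⟩
  have hbd : ∀ U : GaugeConfig d L G, |H U.negReflect * H U| ≤ K * K := by
    intro U
    rw [abs_mul]
    exact mul_le_mul (hK U.negReflect) (hK U) (abs_nonneg _) ((abs_nonneg _).trans (hK U.negReflect))
  have iHϑH : Integrable (fun U => H U.negReflect * H U) μ :=
    integrable_wilson_of_bdd ρ hρ β ((hHm.comp hϑm).mul hHm) ⟨K * K, hbd⟩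
  have hHϑ : ∫ U, H U.negReflect ∂μ = c := integral_comp_negReflect_odd ρ hL hρ β H
  -- expand `∫ A · A∘ϑ = ∫ H∘ϑ · H − c²`
  have hexp : (fun U => A U * A U.negReflect) =
      fun U => (H U.negReflect * H U - c * H U) - (c * H U.negReflect - c * c) := by
    funext U
    simp only [hA, negReflect_negReflect_config]
    ring
  have i1 : Integrable (fun U => H U.negReflect * H U - c * H U) μ := iHϑH.sub (iH.const_mul c)
  have i2 : Integrable (fun U => c * H U.negReflect - c * c) μ := (iHϑ.const_mul c).sub (integrable_const _)
  rw [hexp, integral_sub i1 i2, integral_sub iHϑH (iH.const_mul c), integral_sub (iHϑ.const_mul c) (integrable_const _),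
    integral_const_mul, integral_const_mul, hHϑ, integral_const, smul_eq_mul, probReal_univ, ← hc] at h0
  nlinarith [h0]

/-! ## §2 The mirror sequence: positivity and log-convexity in the time separation -/

/-- **The mirror sequence** of a real torus observable `F`: `q(n) = ∫ (F∘ϑ) · (timeShift n F) − (∫F)(∫ timeShift n F)`,
i.e. `Cov_T(F∘ϑ, F_n)` — the mirror form of `F` against its translate `n` lattice units away from the mirror. -/
def mirrorSeq (β : ℝ) (F : GaugeConfig d L G → ℝ) (n : ℕ) : ℝ :=
  ∫ U, F U.negReflect * timeShift n F U ∂(wilsonMeasure ρ β) -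
    (∫ U, F U ∂(wilsonMeasure ρ β)) * (∫ U, timeShift n F U ∂(wilsonMeasure ρ β))

/-- The mirror sequence with the translate's mean rewritten: `q(n) = ∫ (F∘ϑ)·F_n − (∫F)²`. [folklore] -/
theorem mirrorSeq_eq (β : ℝ) (F : GaugeConfig d L G → ℝ) (n : ℕ) :
    mirrorSeq ρ β F n = ∫ U, F U.negReflect * timeShift n F U ∂(wilsonMeasure ρ β) -
      (∫ U, F U ∂(wilsonMeasure ρ β)) ^ 2 := by
  rw [mirrorSeq, integral_timeShift, sq]

/-- The pairing of two translates is an entry of the mirror sequence: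
`∫ (F_s∘ϑ)·F_t − (∫F_s)(∫F_t) = q(s+t)`. [cite: OsterwalderSeiler1978, §2] -/
theorem cov_timeShift_negReflect_timeShift (β : ℝ) (F : GaugeConfig d L G → ℝ) (s t : ℕ) :
    ∫ U, timeShift s F U.negReflect * timeShift t F U ∂(wilsonMeasure ρ β) -
        (∫ U, timeShift s F U ∂(wilsonMeasure ρ β)) * (∫ U, timeShift t F U ∂(wilsonMeasure ρ β)) =
      mirrorSeq ρ β F (s + t) := by
  rw [integral_negReflect_timeShift_mul_timeShift, mirrorSeq, integral_timeShift, integral_timeShift, integral_timeShift]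

omit [TopologicalSpace G] [IsTopologicalGroup G] [CompactSpace G] [BorelSpace G] [Group G] [NeZero L] in
/-- Measurability of a translate. [folklore] -/
theorem measurable_timeShift {F : GaugeConfig d L G → ℝ} (hFm : Measurable F) (n : ℕ) :
    Measurable (timeShift n F) :=
  hFm.comp (torusConfigShift (G := G) (-(shiftVec (d := d) (L := L) n))).measurable

omit [TopologicalSpace G] [IsTopologicalGroup G] [CompactSpace G] [BorelSpace G] [Group G] [MeasurableSpace G]
  [NeZero d] [NeZero L] in
/-- Boundedness of a translate. [folklore] -/
theorem bdd_timeShift [MeasurableSpace G] [NeZero d] {F : GaugeConfig d L G → ℝ} (hFb : ∃ K : ℝ, ∀ U, |F U| ≤ K)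
    (n : ℕ) : ∃ K : ℝ, ∀ U, |timeShift n F U| ≤ K :=
  hFb.imp fun _ hK _ => hK _

/-- **Even entries are non-negative** (site-reflection positivity of the translate `F_s`): for `F` of the slab
`0 ≤ t ≤ T` and `T + s ≤ S`, `0 ≤ q(2s)`. [cite: OsterwalderSeiler1978, §2] -/
theorem mirrorSeq_even_nonneg {S : ℕ} (hL : L = 2 * S + 1) (hS : 1 ≤ S) (hρ : Continuous ρ) {β : ℝ} (hβ : 0 ≤ β)
    {F : GaugeConfig d L G → ℝ} (hFm : Measurable F) (hFb : ∃ K : ℝ, ∀ U, |F U| ≤ K) {T : ℕ}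
    (hFdep : DependsOn F (slab (d := d) (L := L) 0 T)) {s : ℕ} (hs : T + s ≤ S) :
    0 ≤ mirrorSeq ρ β F (2 * s) := by
  have hdep := (dependsOn_timeShift hFdep (n := s) (by omega)).mono (slab_subset_posHalf hs)
  have h := cov_negReflect_self_nonneg_odd_pos ρ hL hS hρ hβ (measurable_timeShift hFm s) (bdd_timeShift hFb s) hdep
  rw [sq, cov_timeShift_negReflect_timeShift, ← two_mul] at h
  exact h

omit [TopologicalSpace G] [IsTopologicalGroup G] [CompactSpace G] [BorelSpace G] [Group G] [MeasurableSpace G] in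
/-- A slab `[lo, hi]` with `1 ≤ lo` and `hi ≤ S` (side `2S+1`) lies in the link-reflection half
`oPosEdges ∪ oSharedEdges`. [folklore] -/
theorem slab_subset_oPos {S lo hi : ℕ} (hL : L = 2 * S + 1) (hlo : 1 ≤ lo) (hhi : hi ≤ S) :
    slab (d := d) (L := L) lo hi ⊆ ((oPosEdges ∪ oSharedEdges : Finset (Edge d L)) : Set (Edge d L)) := by
  intro e he
  obtain ⟨h0, h1, -⟩ := he
  rw [mem_coe, mem_union, mem_oPosEdges]
  left
  refine ⟨hlo.trans h0, ?_⟩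
  have : L / 2 = S := by omega
  rw [this]
  exact h1.trans hhi

/-- **Odd entries are non-negative** (LINK-reflection positivity of the translate `F_{s+1}`): for `F` of the slab
`0 ≤ t ≤ T` and `T + s + 1 ≤ S`, `0 ≤ q(2s+1)`. [cite: OsterwalderSeiler1978, §2] -/
theorem mirrorSeq_odd_nonneg {S : ℕ} (hL : L = 2 * S + 1) (hS : 1 ≤ S) (hρ : Continuous ρ) {β : ℝ} (hβ : 0 ≤ β)
    {F : GaugeConfig d L G → ℝ} (hFm : Measurable F) (hFb : ∃ K : ℝ, ∀ U, |F U| ≤ K) {T : ℕ}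
    (hFdep : DependsOn F (slab (d := d) (L := L) 0 T)) {s : ℕ} (hs : T + s + 1 ≤ S) :
    0 ≤ mirrorSeq ρ β F (2 * s + 1) := by
  have hodd : Odd L := ⟨S, hL⟩
  have hL3 : 3 ≤ L := by omega
  have hdep := (dependsOn_timeShift hFdep (n := s + 1) (by omega)).mono
    (slab_subset_oPos (d := d) hL (by omega) (by omega))
  have h := cov_timeReflect_self_nonneg_odd ρ hodd hL3 hρ hβ (measurable_timeShift hFm (s + 1))
    (bdd_timeShift hFb (s + 1)) hdep
  have hmul : (fun U => timeShift (s + 1) F U * timeShift (s + 1) F U.timeReflect) =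
      fun U => timeShift s F U.negReflect * timeShift (s + 1) F U := by
    funext U; rw [timeShift_succ_timeReflect, mul_comm]
  rw [hmul, integral_timeShift] at h
  rw [mirrorSeq_eq, show 2 * s + 1 = s + (s + 1) by ring, ← integral_negReflect_timeShift_mul_timeShift]
  exact h

/-- **The mirror sequence is non-negative** as long as the translate stays in the non-negative half:
`0 ≤ q(n)` for `2T + n ≤ 2S`. [cite: OsterwalderSeiler1978, §2] -/
theorem mirrorSeq_nonneg {S : ℕ} (hL : L = 2 * S + 1) (hS : 1 ≤ S) (hρ : Continuous ρ) {β : ℝ} (hβ : 0 ≤ β)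
    {F : GaugeConfig d L G → ℝ} (hFm : Measurable F) (hFb : ∃ K : ℝ, ∀ U, |F U| ≤ K) {T : ℕ}
    (hFdep : DependsOn F (slab (d := d) (L := L) 0 T)) {n : ℕ} (hn : 2 * T + n ≤ 2 * S) :
    0 ≤ mirrorSeq ρ β F n := by
  obtain ⟨s, rfl | rfl⟩ := Nat.even_or_odd' n
  · exact mirrorSeq_even_nonneg ρ hL hS hρ hβ hFm hFb hFdep (by omega)
  · exact mirrorSeq_odd_nonneg ρ hL hS hρ hβ hFm hFb hFdep (by omega)

/-- **Site RPCS in Hankel form**: `q(s+t)² ≤ q(2s) · q(2t)` (`T + s ≤ S`, `T + t ≤ S`).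
[cite: FrohlichIsraelLiebSimon1978, Thm. 2.1] -/
theorem sq_mirrorSeq_add_le {S : ℕ} (hL : L = 2 * S + 1) (hS : 1 ≤ S) (hρ : Continuous ρ) {β : ℝ} (hβ : 0 ≤ β)
    {F : GaugeConfig d L G → ℝ} (hFm : Measurable F) (hFb : ∃ K : ℝ, ∀ U, |F U| ≤ K) {T : ℕ}
    (hFdep : DependsOn F (slab (d := d) (L := L) 0 T)) {s t : ℕ} (hs : T + s ≤ S) (ht : T + t ≤ S) :
    mirrorSeq ρ β F (s + t) ^ 2 ≤ mirrorSeq ρ β F (2 * s) * mirrorSeq ρ β F (2 * t) := by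
  have hdeps := (dependsOn_timeShift hFdep (n := s) (by omega)).mono (slab_subset_posHalf hs)
  have hdept := (dependsOn_timeShift hFdep (n := t) (by omega)).mono (slab_subset_posHalf ht)
  have h := sq_cov_negReflect_le_odd_pos ρ hL hS hρ hβ (measurable_timeShift hFm s) (measurable_timeShift hFm t)
    (bdd_timeShift hFb s) (bdd_timeShift hFb t) hdeps hdept
  rw [sq (∫ U, timeShift s F U ∂_), sq (∫ U, timeShift t F U ∂_), cov_timeShift_negReflect_timeShift,
    cov_timeShift_negReflect_timeShift, cov_timeShift_negReflect_timeShift, ← two_mul, ← two_mul] at h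
  exact h

/-- **Link RPCS in Hankel form**: `q(s+t+1)² ≤ q(2s+1) · q(2t+1)` (`T + s + 1 ≤ S`, `T + t + 1 ≤ S`).
[cite: FrohlichIsraelLiebSimon1978, Thm. 2.1] -/
theorem sq_mirrorSeq_add_succ_le {S : ℕ} (hL : L = 2 * S + 1) (hS : 1 ≤ S) (hρ : Continuous ρ) {β : ℝ}
    (hβ : 0 ≤ β) {F : GaugeConfig d L G → ℝ} (hFm : Measurable F) (hFb : ∃ K : ℝ, ∀ U, |F U| ≤ K) {T : ℕ}
    (hFdep : DependsOn F (slab (d := d) (L := L) 0 T)) {s t : ℕ} (hs : T + s + 1 ≤ S) (ht : T + t + 1 ≤ S) :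
    mirrorSeq ρ β F (s + t + 1) ^ 2 ≤ mirrorSeq ρ β F (2 * s + 1) * mirrorSeq ρ β F (2 * t + 1) := by
  have hodd : Odd L := ⟨S, hL⟩
  have hL3 : 3 ≤ L := by omega
  have hdeps := (dependsOn_timeShift hFdep (n := s + 1) (by omega)).mono
    (slab_subset_oPos (d := d) hL (by omega) (by omega))
  have hdept := (dependsOn_timeShift hFdep (n := t + 1) (by omega)).mono
    (slab_subset_oPos (d := d) hL (by omega) (by omega))
  have h := sq_cov_timeReflect_le_odd ρ hodd hL3 hρ hβ (measurable_timeShift hFm (s + 1))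
    (measurable_timeShift hFm (t + 1)) (bdd_timeShift hFb (s + 1)) (bdd_timeShift hFb (t + 1)) hdeps hdept
  -- rewrite every pairing `∫ F_{a+1} · F_{b+1}∘Θ` as `∫ (F_b∘ϑ) · F_{a+1}`
  have hpair : ∀ a b : ℕ, ∫ U, timeShift (a + 1) F U * timeShift (b + 1) F U.timeReflect ∂(wilsonMeasure ρ β) -
      (∫ U, timeShift (a + 1) F U ∂(wilsonMeasure ρ β)) * (∫ U, timeShift (b + 1) F U ∂(wilsonMeasure ρ β)) =
      mirrorSeq ρ β F (a + b + 1) := by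
    intro a b
    have hmul : (fun U => timeShift (a + 1) F U * timeShift (b + 1) F U.timeReflect) =
        fun U => timeShift b F U.negReflect * timeShift (a + 1) F U := by
      funext U; rw [timeShift_succ_timeReflect, mul_comm]
    rw [hmul, integral_timeShift ρ β (b + 1), ← integral_timeShift ρ β b F, mul_comm (∫ U, timeShift (a + 1) F U ∂_),
      cov_timeShift_negReflect_timeShift, show b + (a + 1) = a + b + 1 by ring]
  rw [sq (∫ U, timeShift (s + 1) F U ∂_), sq (∫ U, timeShift (t + 1) F U ∂_), hpair, hpair, hpair,
    show s + s + 1 = 2 * s + 1 by ring, show t + t + 1 = 2 * t + 1 by ring] at h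
  exact h

/-- **Log-convexity of the mirror sequence in the time separation**: `q(n+1)² ≤ q(n) · q(n+2)` for every `n` with
`2T + n + 2 ≤ 2S` (even `n`: site RPCS between `F_{n/2}` and `F_{n/2+1}`; odd `n`: link RPCS between `F_{(n+1)/2}` and
`F_{(n+3)/2}`). [cite: FrohlichIsraelLiebSimon1978, Thm. 2.1] -/
theorem mirrorSeq_logConvex {S : ℕ} (hL : L = 2 * S + 1) (hS : 1 ≤ S) (hρ : Continuous ρ) {β : ℝ} (hβ : 0 ≤ β)
    {F : GaugeConfig d L G → ℝ} (hFm : Measurable F) (hFb : ∃ K : ℝ, ∀ U, |F U| ≤ K) {T : ℕ}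
    (hFdep : DependsOn F (slab (d := d) (L := L) 0 T)) {n : ℕ} (hn : 2 * T + n + 2 ≤ 2 * S) :
    mirrorSeq ρ β F (n + 1) ^ 2 ≤ mirrorSeq ρ β F n * mirrorSeq ρ β F (n + 2) := by
  obtain ⟨s, rfl | rfl⟩ := Nat.even_or_odd' n
  · have h := sq_mirrorSeq_add_le ρ hL hS hρ hβ hFm hFb hFdep (s := s) (t := s + 1) (by omega) (by omega)
    simpa only [show s + (s + 1) = 2 * s + 1 by ring, show 2 * (s + 1) = 2 * s + 2 by ring] using h
  · have h := sq_mirrorSeq_add_succ_le ρ hL hS hρ hβ hFm hFb hFdep (s := s) (t := s + 1) (by omega) (by omega)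
    simpa only [show s + (s + 1) + 1 = 2 * s + 1 + 1 by ring, show 2 * (s + 1) + 1 = 2 * s + 1 + 2 by ring] using h

end Summit.QuantumFields.YangMills.Cruxes.NT.MirrorHankel

end
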